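import Summits.BirchSwinnertonDyer.Rank1Residual.O5.O5KummerLine
import Summits.BirchSwinnertonDyer.Rank1Residual.Additive.WildThreeKrausCells
import HarnessLib

/-!
# V10-SHAPE: the SHAPE of `W[3]|G_{ℚ₃}` at a wild additive `3` — six census-decidable shapes
# `IRR / SPLIT / ORD1 / ORDM / ET1 / ETM`, their PROVED partition of the reducible locus, and the
# vocabulary the O6 sub-partition (A)/(B)/(C) of the residue R-O6-5′ is typed in
# (cell `b2b-bsdres`, lane CLASS-CLOSURE, class O6, seat cc-typer-5 GEN 7 = O5/O6 typer of record;
#  content = o6-r1 GEN 10 memo `HOME/b2b-bsdres-o6-r1/gen10/O6-GEN10.md` §2; placement, dedup and Lean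
#  phrasing = class typer; EVIDENCE-labelled; 0 `@[conjecture]` nodes in THIS file, 0 Literature facts)

HONEST FRAMING (cell `b2b-bsdres`, run/shared/lean/b2b/bsd-rank1-residual/, verbatim in every file):
the goal of the cell is to DELETE the COMBINATION-SHAPED residual classes of the Birch–Swinnerton-Dyer
formula for ALL analytic-rank `≤ 1` elliptic curves over `ℚ` — "full BSD formula for every rank `≤ 1`
curve in class `C`" assembled STRICTLY from published theorems — so that the rank-`≤ 1` remainder
becomes exactly the CONSTRUCTION-SHAPED classes, which are TYPED (missing-input `Prop`s), NOT
attempted. This is not "finishing BSD". Lane CLASS-CLOSURE (`CLASS-CLOSURE-PLAN.md` §3.4 O6,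
experiment type (2) OBSTRUCTION ANATOMY → SUB-PARTITION): research routes; no claim beyond the stated
classes; census output is EVIDENCE, never a Literature fact; nothing is booked; no mark of
`RESIDUAL-MAP.md` moves. This file: census-decidable PREDICATES (the six local shapes) with PROVED
partition lemmas; the SHAPE LAW, the partner law and the transport SHAPE that READ these predicates are
the sequel `Additive/WildThreeResidualShapeLaws.lean`. Nothing about any curve is asserted here.

## What (o6-r1 GEN 10, `O6-GEN10.md` §2 "V10-SHAPE", census `gen10/shape/shape_census.py`
## 3793c5c21e5d7304 → `shape_rows.tsv.gz`, `shape_summary.json`; universe U = o6-r2 G4 = 154 058 O6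
## classes, Cremona `N ≤ 500 000`, `ρ̄₃` with no rational `3`-isogeny; undecided 0)

DEFINITION (o6-r1, computable; typed here verbatim in content). The `G_{ℚ₃}`-stable lines
`⟨P⟩ ⊂ W[3]` are the `ℚ₃`-roots `x₀` of the `3`-division polynomial `Ψ₃` (`x(P) = x₀`; the tree's
`O5.numStableLinesAtThree W` counts them). No root: **IRR** (`= LocIrr W 3`, `Additive/FouquetWanLocus`,
via the elementary "irreducible plane ⟺ no stable line", O5's `LocalShapeTprimeThree`). Two roots:
**SPLIT** (`W[3]|G_{ℚ₃} ≅ s ⊕ sω`, semisimple). One root `x₀`: `G_{ℚ₃}` acts on the line `{0, ±P}` by the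
quadratic character of `ℚ₃(√F(x₀))/ℚ₃`, `F(x₀) := Ψ₂²(x₀) = 4x₀³ + b₂x₀² + 2b₄x₀ + b₆ = (2y(P) + a₁x₀ + a₃)²`,
i.e. by `s ∈ {1, μ, ω, μω}` (`μ` = unramified quadratic = `ℚ₃(√−1) = ℚ₉`, `ω` = mod-`3` cyclotomic =
`ℚ₃(√−3)`, `μω` ↔ `ℚ₃(√3)`), READ OFF the square class of `F(x₀) ∈ ℚ₃ˣ/(ℚ₃ˣ)² = {1, −1, −3, 3}`, that is
off `(parity of v₃ F(x₀), unit part mod 3)`: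
* `v₃` even, unit part `≡ 1 (mod 3)` ⇒ `s = 1`: **ET1** (`P ∈ W(ℚ₃)`, local `3`-torsion);
* `v₃` even, unit part `≡ 2 (mod 3)` ⇒ `s = μ`: **ETM**;
* `v₃` odd, unit part `≡ 2 (mod 3)` ⇒ `s = ω`: **ORD1** (line `≅ μ₃`; O5KummerLine's "lineclass 12");
* `v₃` odd, unit part `≡ 1 (mod 3)` ⇒ `s = μω`: **ORDM** (O5KummerLine's `StableLineNonCyclotomicThree`,
  "lineclass 11").
`ORD* = "sub = ω · unramified"` (the shape of an ordinary or multiplicative newform's `ρ̄`), `ET* =` its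
`ω`-twist (sub unramified, quotient ramified); the `−3` twist swaps `ORD1 ↔ ET1`, `ORDM ↔ ETM` and fixes
`IRR`, `SPLIT` (checked on 4 996 located twist partners, 9 partner-identification suspects).

VALIDATION (o6-r1; EVIDENCE): gen-2 `tors3loc` 16 982/16 982 (`ET1 ⟺ #W(ℚ₃)[3] = 3`); PARI
`polrootspadic` 131/131; cc-eng-2 X3E certified partners 20 321/20 321 (P-SHAPE-PARTNER, sequel file).

## What is typed here, and what is PROVED

* §1 the `3`-adic sign data of a non-zero `t ∈ ℚ₃`: `unitPartThree t := t·3^{−v₃(t)}` (a `3`-adic unit,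
  PROVED `norm_unitPartThree`), `UnitPartCongThree t ε := ‖unitPartThree t − ε‖ < 1`; PROVED: for `t ≠ 0`
  exactly one of `ε = 1`, `ε = −1` holds (`unitPartCongThree_one_or_neg_one`, `…_not_both`) — the
  residue field of `ℤ₃` is `𝔽₃` (Mathlib `PadicInt.toZMod`), nothing deeper.
* §2 the six shapes as `Prop`-valued predicates of `W : WeierstrassCurve ℚ` (polynomial shadows over
  `ℚ₃`, house style of `O5KummerLine.StableLineNonCyclotomicThree` / `NoLocalThreeTorsionAt`):
  `ShapeIrrThree`, `ShapeSplitThree`, `ShapeET1Three`, `ShapeETMThree`, `ShapeORD1Three`,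
  `ShapeORDMThree`, the sides `ShapeEtSideThree := ET1 ∨ ETM`, `ShapeOrdSideThree := ORD1 ∨ ORDM`; the
  stable-line sign `stableLineSignThree W x₀ := Ψ₂²(x₀)` over `ℚ₃`.
* §3 PROVED partition bookkeeping: the six shapes EXHAUST every `W` whose unique stable line has
  `F(x₀) ≠ 0` (`shape_exhaustive`; `F(x₀) = 0` would make `P` `2`-torsion — an explicit hypothesis,
  automatic for elliptic `W`), the one-line shapes are pairwise EXCLUSIVE, IRR / SPLIT exclude the rest;
  dictionary: `ShapeIrrThree W ↔ O5.numStableLinesAtThree W = 0`, and `StableLineNonCyclotomicThree`'s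
  square form `3·s²` is the ORDM sign datum (`unitPartCongThree_one_of_eq_three_mul_sq`).
* NOT typed here (sequel `WildThreeResidualShapeLaws.lean`): the SHAPE LAW by `(v₃N, Kodaira)`
  (EVIDENCE 154 058/154 058), P-SHAPE-PARTNER (EVIDENCE 20 321/0), the sub-partition (A)/(B)/(C) of
  R-O6-5′ (421 + 725 + 927 = 2 073) and the non-generic transport SHAPE T-O6-NG.

DEDUP (OWNERS §0 item 7): `LocIrr`, `numStableLinesAtThree`, `LocalShapeTprimeThree`, `NonSplitAtThreeLaw`,
`CompanionTypeLawThree`, `StableLineNonCyclotomicThree`, `LocIrrCriterionThree` are IMPORTED and bridged,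
not re-declared (the O5 nodes are restricted to the tame cell; these predicates carry no restriction).

References: J.-P. Serre, Invent. Math. 15 (1972) §1.11 (local shapes of `E[p]`) [Serre1972]; o6-r1
GEN 10 memo `O6-GEN10.md` §2–§3 (cell EVIDENCE); `cells/o5o6/TARGETS.md` §O6 GEN 10; `O6/TYPED.md` §11.
-/

set_option autoImplicit false

noncomputable section

open scoped Classical

open Polynomial WeierstrassCurve Literature.NumberTheory.EllipticCurves
  Literature.NumberTheory.EllipticCurves.Rank1Residual
  Literature.NumberTheory.EllipticCurves.Rank1Residual.Typed

namespace Summit.BirchSwinnertonDyer.Rank1Residual.Additive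

/-! ## §1 `3`-adic sign data (PROVED: exhaustive and exclusive) -/

section SignData

/-- The **unit part** `t · 3^{−v₃(t)}` of `t ∈ ℚ₃` (a `3`-adic unit when `t ≠ 0`). [folklore] -/
def unitPartThree (t : ℚ_[3]) : ℚ_[3] := t * ((3 : ℕ) : ℚ_[3]) ^ (-t.valuation)

/-- **`unit part of t ≡ ε (mod 3)`**: `‖t·3^{−v₃(t)} − ε‖₃ < 1`.  Used with `ε = 1` / `ε = −1`, the two
classes of `ℤ₃ˣ/(1 + 3ℤ₃) = 𝔽₃ˣ`. [folklore] -/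
def UnitPartCongThree (t ε : ℚ_[3]) : Prop := ‖unitPartThree t - ε‖ < 1

/-- The unit part of a non-zero `3`-adic number is a unit. [folklore] -/
theorem norm_unitPartThree {t : ℚ_[3]} (ht : t ≠ 0) : ‖unitPartThree t‖ = 1 := by
  unfold unitPartThree
  rw [norm_mul, Padic.norm_eq_zpow_neg_valuation ht, Padic.norm_p_zpow,
    ← zpow_add₀ (by norm_num : ((3 : ℕ) : ℝ) ≠ 0), neg_neg, neg_add_cancel, zpow_zero]

/-- In `ℤ₃` membership in the maximal ideal is `‖·‖ < 1`. [folklore] -/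
private theorem mem_maximalIdeal_iff_norm_lt_one (z : ℤ_[3]) :
    z ∈ IsLocalRing.maximalIdeal ℤ_[3] ↔ ‖z‖ < 1 := by
  rw [IsLocalRing.mem_maximalIdeal, PadicInt.mem_nonunits]

/-- **Exhaustive**: the unit part of `t ≠ 0` is `≡ 1` or `≡ −1 (mod 3)` — the residue field of `ℤ₃`
is `𝔽₃ = {0, 1, 2}` and a unit does not reduce to `0`. [folklore] -/
theorem unitPartCongThree_one_or_neg_one {t : ℚ_[3]} (ht : t ≠ 0) :
    UnitPartCongThree t 1 ∨ UnitPartCongThree t (-1) := by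
  have hu : ‖unitPartThree t‖ = 1 := norm_unitPartThree ht
  set u := unitPartThree t with hu_def
  let z : ℤ_[3] := ⟨u, hu.le⟩
  have hz : (z : ℚ_[3]) = u := rfl
  have hspec := PadicInt.toZMod_spec z
  have hcases : ∀ r : ZMod 3, r = 0 ∨ r = 1 ∨ r = 2 := by decide
  rcases hcases (PadicInt.toZMod z) with h0 | h1 | h2
  · exfalso
    have hmem : z ∈ IsLocalRing.maximalIdeal ℤ_[3] := by
      rw [h0, ZMod.cast_zero, sub_zero] at hspec
      exact hspec
    have hlt : ‖z‖ < 1 := (mem_maximalIdeal_iff_norm_lt_one z).1 hmem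
    rw [PadicInt.norm_def, hz, hu] at hlt
    exact lt_irrefl _ hlt
  · left
    have hmem : z - 1 ∈ IsLocalRing.maximalIdeal ℤ_[3] := by
      have h1' : (ZMod.cast (PadicInt.toZMod z) : ℤ_[3]) = 1 := by
        rw [h1, ZMod.cast_eq_val, ZMod.val_one, Nat.cast_one]
      simpa [h1'] using hspec
    have hlt : ‖z - 1‖ < 1 := (mem_maximalIdeal_iff_norm_lt_one _).1 hmem
    rw [PadicInt.norm_def, PadicInt.coe_sub, PadicInt.coe_one, hz] at hlt
    exact hlt
  · right
    have hmem : z - 2 ∈ IsLocalRing.maximalIdeal ℤ_[3] := by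
      have h2' : (ZMod.cast (PadicInt.toZMod z) : ℤ_[3]) = 2 := by
        rw [h2, ZMod.cast_eq_val, ZMod.val_two_eq_two_mod]
        norm_num
      simpa [h2'] using hspec
    have hlt : ‖z - 2‖ < 1 := (mem_maximalIdeal_iff_norm_lt_one _).1 hmem
    have hcoe : ((z - 2 : ℤ_[3]) : ℚ_[3]) = u - 2 := by
      rw [PadicInt.coe_sub, hz]
      norm_cast
    rw [PadicInt.norm_def, hcoe] at hlt
    -- `u + 1 = (u − 2) + 3` and `‖3‖₃ < 1`
    have h3 : ‖((3 : ℕ) : ℚ_[3])‖ < 1 := Padic.norm_p_lt_one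
    have heq : u - (-1) = (u - 2) + ((3 : ℕ) : ℚ_[3]) := by push_cast; ring
    show ‖u - (-1)‖ < 1
    rw [heq]
    exact (Padic.nonarchimedean _ _).trans_lt (max_lt hlt h3)

/-- **Exclusive**: the unit part is not both `≡ 1` and `≡ −1 (mod 3)` (`‖2‖₃ = 1`). [folklore] -/
theorem unitPartCongThree_not_both (t : ℚ_[3]) :
    ¬ (UnitPartCongThree t 1 ∧ UnitPartCongThree t (-1)) := by
  rintro ⟨h1, h2⟩
  unfold UnitPartCongThree at h1 h2
  set u := unitPartThree t
  have htwo : ‖((2 : ℕ) : ℚ_[3])‖ = 1 := by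
    rw [Padic.norm_natCast_eq_one_iff]
    decide
  have heq : ((2 : ℕ) : ℚ_[3]) = (u - (-1)) + (-(u - 1)) := by push_cast; ring
  have hlt : ‖((2 : ℕ) : ℚ_[3])‖ < 1 := by
    rw [heq]
    refine (Padic.nonarchimedean _ _).trans_lt (max_lt h2 ?_)
    rwa [norm_neg]
  rw [htwo] at hlt
  exact lt_irrefl _ hlt

/-- If `t = 3·s²` with `s ≠ 0` then `v₃(t)` is ODD and the unit part of `t` is `≡ 1 (mod 3)` (it is the
square of the unit part of `s`): the square form `Ψ₂²(x₀) = 3·s²` of `O5.StableLineNonCyclotomicThree`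
is the ORDM sign datum. [folklore] -/
theorem odd_valuation_of_eq_three_mul_sq {t s : ℚ_[3]} (hs : s ≠ 0) (h : t = 3 * s ^ 2) :
    Odd t.valuation := by
  have h3 : (3 : ℚ_[3]) ≠ 0 := by norm_num
  have hs2 : s ^ 2 ≠ 0 := pow_ne_zero 2 hs
  have hv3 : (3 : ℚ_[3]).valuation = 1 := by simp
  rw [h, Padic.valuation_mul h3 hs2, Padic.valuation_pow, hv3]
  exact ⟨s.valuation, by ring⟩

end SignData

/-! ## §2 The six local shapes of `W[3]|G_{ℚ₃}` (census-decidable predicates; nothing asserted) -/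

section Shapes

variable (W : WeierstrassCurve ℚ)

/-- The **sign of the stable line** through the `Ψ₃`-root `x₀`: `F(x₀) := Ψ₂²(x₀) = (2y(P) + a₁x₀ + a₃)²`,
whose square class in `ℚ₃ˣ/(ℚ₃ˣ)²` is the quadratic character by which `G_{ℚ₃}` acts on `{0, ±P}`.
[folklore] -/
def stableLineSignThree (x₀ : ℚ_[3]) : ℚ_[3] := ((W.baseChange ℚ_[3]).Ψ₂Sq).eval x₀

/-- `x₀` is THE stable-line abscissa of `W` at `3`: a `ℚ₃`-root of `Ψ₃`, and the only one (shape
"exactly one stable line", `numStableLinesAtThree W = 1`). [folklore] -/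
def IsUniqueStableLineThree (x₀ : ℚ_[3]) : Prop :=
  ((W.baseChange ℚ_[3]).Ψ₃).IsRoot x₀ ∧ ∀ r : ℚ_[3], ((W.baseChange ℚ_[3]).Ψ₃).IsRoot r → r = x₀

/-- **IRR**: `Ψ₃` has no root in `ℚ₃` — no `G_{ℚ₃}`-stable line, `W[3]|G_{ℚ₃}` irreducible (the decidable
shadow of `LocIrr W 3`; census `nroots = 0`). [folklore] -/
def ShapeIrrThree : Prop := ∀ r : ℚ_[3], ¬ ((W.baseChange ℚ_[3]).Ψ₃).IsRoot r

/-- **SPLIT**: two distinct `ℚ₃`-roots of `Ψ₃` — two stable lines, `W[3]|G_{ℚ₃} ≅ s ⊕ sω` semisimple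
(census `nroots = 2`; `W[3]|I₃` tame although `W` is wild: Swan conductor `1`). [folklore] -/
def ShapeSplitThree : Prop :=
  ∃ r r' : ℚ_[3], r ≠ r' ∧ ((W.baseChange ℚ_[3]).Ψ₃).IsRoot r ∧ ((W.baseChange ℚ_[3]).Ψ₃).IsRoot r'

/-- **ET1**: one stable line, acted on TRIVIALLY (`F(x₀)` a non-zero square: `v₃` even, unit part `≡ 1`):
`P ∈ W(ℚ₃)`, local `3`-torsion (census: `⟺ tors3loc = 3`, 16 982/16 982). [folklore] -/
def ShapeET1Three : Prop :=
  ∃ x₀ : ℚ_[3], IsUniqueStableLineThree W x₀ ∧ stableLineSignThree W x₀ ≠ 0 ∧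
    Even (stableLineSignThree W x₀).valuation ∧ UnitPartCongThree (stableLineSignThree W x₀) 1

/-- **ETM**: one stable line, character `μ` (unramified quadratic: `F(x₀) ∈ −1·(ℚ₃ˣ)²`, `v₃` even, unit
part `≡ 2`). [folklore] -/
def ShapeETMThree : Prop :=
  ∃ x₀ : ℚ_[3], IsUniqueStableLineThree W x₀ ∧ stableLineSignThree W x₀ ≠ 0 ∧
    Even (stableLineSignThree W x₀).valuation ∧ UnitPartCongThree (stableLineSignThree W x₀) (-1)

/-- **ORD1**: one stable line, character `ω` (`F(x₀) ∈ −3·(ℚ₃ˣ)²`: `v₃` odd, unit part `≡ 2`): the line is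
`≅ μ₃` — the shape of a good-ordinary ANOMALOUS or SPLIT-multiplicative `ρ̄` ("lineclass 12"). [folklore] -/
def ShapeORD1Three : Prop :=
  ∃ x₀ : ℚ_[3], IsUniqueStableLineThree W x₀ ∧ stableLineSignThree W x₀ ≠ 0 ∧
    Odd (stableLineSignThree W x₀).valuation ∧ UnitPartCongThree (stableLineSignThree W x₀) (-1)

/-- **ORDM**: one stable line, character `μω` (`F(x₀) ∈ 3·(ℚ₃ˣ)²`: `v₃` odd, unit part `≡ 1`) — the shape
of a good-ordinary NON-anomalous or NON-SPLIT-multiplicative `ρ̄` ("lineclass 11",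
`O5.StableLineNonCyclotomicThree`). [folklore] -/
def ShapeORDMThree : Prop :=
  ∃ x₀ : ℚ_[3], IsUniqueStableLineThree W x₀ ∧ stableLineSignThree W x₀ ≠ 0 ∧
    Odd (stableLineSignThree W x₀).valuation ∧ UnitPartCongThree (stableLineSignThree W x₀) 1

/-- **ET-side** `= ET1 ∨ ETM`: sub unramified, quotient ramified (o6-r1's class (C)). [folklore] -/
def ShapeEtSideThree : Prop := ShapeET1Three W ∨ ShapeETMThree W

/-- **ORD-side** `= ORD1 ∨ ORDM`: sub `= ω ·` unramified (with SPLIT, o6-r1's class (B)). [folklore] -/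
def ShapeOrdSideThree : Prop := ShapeORD1Three W ∨ ShapeORDMThree W

end Shapes

/-! ## §3 Partition bookkeeping (PROVED) and the dictionary with the tree -/

section Partition

variable (W : WeierstrassCurve ℚ)

/-- A unique stable line is unique: two witnesses of `IsUniqueStableLineThree` coincide. [folklore] -/
theorem IsUniqueStableLineThree.eq {W : WeierstrassCurve ℚ} {x₀ x₁ : ℚ_[3]}
    (h₀ : IsUniqueStableLineThree W x₀) (h₁ : IsUniqueStableLineThree W x₁) : x₁ = x₀ :=
  h₀.2 x₁ h₁.1

/-- **EXHAUSTIVE.** Every `W` is IRR, SPLIT, or has exactly one stable line; and if that line's sign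
`F(x₀)` is non-zero (automatic for elliptic `W`: a point of order `3` is not `2`-torsion) then `W` is
ET1, ETM, ORD1 or ORDM — parity of `v₃` and the unit part mod `3` each take exactly two values (§1).
No curve is lost by the six-shape split. [folklore] -/
theorem shape_exhaustive
    (hF : ∀ x₀ : ℚ_[3], IsUniqueStableLineThree W x₀ → stableLineSignThree W x₀ ≠ 0) :
    ShapeIrrThree W ∨ ShapeSplitThree W ∨
      ShapeET1Three W ∨ ShapeETMThree W ∨ ShapeORD1Three W ∨ ShapeORDMThree W := by
  by_cases hirr : ShapeIrrThree W
  · exact Or.inl hirr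
  obtain ⟨x₀, hx₀⟩ : ∃ r : ℚ_[3], ((W.baseChange ℚ_[3]).Ψ₃).IsRoot r := by
    simp only [ShapeIrrThree, not_forall, not_not] at hirr
    exact hirr
  by_cases hsplit : ShapeSplitThree W
  · exact Or.inr (Or.inl hsplit)
  have huniq : IsUniqueStableLineThree W x₀ := by
    refine ⟨hx₀, fun r hr ↦ ?_⟩
    by_contra hne
    exact hsplit ⟨r, x₀, hne, hr, hx₀⟩
  have hne := hF x₀ huniq
  right; right
  rcases Int.even_or_odd (stableLineSignThree W x₀).valuation with hev | hodd
  · rcases unitPartCongThree_one_or_neg_one hne with h1 | h2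
    · exact Or.inl ⟨x₀, huniq, hne, hev, h1⟩
    · exact Or.inr (Or.inl ⟨x₀, huniq, hne, hev, h2⟩)
  · rcases unitPartCongThree_one_or_neg_one hne with h1 | h2
    · exact Or.inr (Or.inr (Or.inr ⟨x₀, huniq, hne, hodd, h1⟩))
    · exact Or.inr (Or.inr (Or.inl ⟨x₀, huniq, hne, hodd, h2⟩))

/-- IRR excludes SPLIT and the four one-line shapes. [folklore] -/
theorem ShapeIrrThree.not_others {W : WeierstrassCurve ℚ} (h : ShapeIrrThree W) :
    ¬ ShapeSplitThree W ∧ ¬ ShapeET1Three W ∧ ¬ ShapeETMThree W ∧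
      ¬ ShapeORD1Three W ∧ ¬ ShapeORDMThree W := by
  refine ⟨?_, ?_, ?_, ?_, ?_⟩
  · rintro ⟨r, _, _, hr, _⟩; exact h r hr
  all_goals rintro ⟨x₀, hx, _⟩; exact h x₀ hx.1

/-- SPLIT excludes the four one-line shapes (two distinct roots vs. a unique root). [folklore] -/
theorem ShapeSplitThree.not_oneLine {W : WeierstrassCurve ℚ} (h : ShapeSplitThree W) :
    ¬ ShapeET1Three W ∧ ¬ ShapeETMThree W ∧ ¬ ShapeORD1Three W ∧ ¬ ShapeORDMThree W := by
  obtain ⟨r, r', hne, hr, hr'⟩ := h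
  have key : ∀ x₀, ¬ IsUniqueStableLineThree W x₀ := fun x₀ hx ↦
    hne ((hx.2 r hr).trans (hx.2 r' hr').symm)
  refine ⟨?_, ?_, ?_, ?_⟩
  all_goals rintro ⟨x₀, hx, _⟩; exact key x₀ hx

/-- ET1 and ETM are exclusive (unit part `≡ 1` vs `≡ −1`). [folklore] -/
theorem shapeET1_not_ETM {W : WeierstrassCurve ℚ} (h : ShapeET1Three W) : ¬ ShapeETMThree W := by
  rintro ⟨x₁, hx₁, _, _, h₁⟩
  obtain ⟨x₀, hx₀, _, _, h₀⟩ := h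
  obtain rfl := hx₀.eq hx₁
  exact unitPartCongThree_not_both _ ⟨h₀, h₁⟩

/-- ORD1 and ORDM are exclusive (unit part `≡ −1` vs `≡ 1`). [folklore] -/
theorem shapeORD1_not_ORDM {W : WeierstrassCurve ℚ} (h : ShapeORD1Three W) : ¬ ShapeORDMThree W := by
  rintro ⟨x₁, hx₁, _, _, h₁⟩
  obtain ⟨x₀, hx₀, _, _, h₀⟩ := h
  obtain rfl := hx₀.eq hx₁
  exact unitPartCongThree_not_both _ ⟨h₁, h₀⟩

/-- The ET-side and the ORD-side are exclusive (`v₃ F(x₀)` even vs odd). [folklore] -/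
theorem shapeEtSide_not_ordSide {W : WeierstrassCurve ℚ} (h : ShapeEtSideThree W) :
    ¬ ShapeOrdSideThree W := by
  have hev : ∃ x₀, IsUniqueStableLineThree W x₀ ∧ Even (stableLineSignThree W x₀).valuation := by
    rcases h with ⟨x₀, hx, _, hev, _⟩ | ⟨x₀, hx, _, hev, _⟩ <;> exact ⟨x₀, hx, hev⟩
  obtain ⟨x₀, hx₀, hev⟩ := hev
  rintro (⟨x₁, hx₁, _, hodd, _⟩ | ⟨x₁, hx₁, _, hodd, _⟩)
  all_goals
    obtain rfl := hx₀.eq hx₁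
    exact (Int.not_odd_iff_even.mpr hev) hodd

/-- **Dictionary with `O5.numStableLinesAtThree`**: IRR `⟺` the root count is `0`. [folklore] -/
theorem shapeIrrThree_iff_numStableLines_eq_zero :
    ShapeIrrThree W ↔ O5.numStableLinesAtThree W = 0 := by
  have h3 : (3 : ℚ_[3]) ≠ 0 := by norm_num
  have hne : (W.Ψ₃).map (algebraMap ℚ ℚ_[3]) ≠ 0 := by
    rw [← map_Ψ₃]
    exact Ψ₃_ne_zero _ h3
  have hbc : (W.baseChange ℚ_[3]).Ψ₃ = (W.Ψ₃).map (algebraMap ℚ ℚ_[3]) := by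
    rw [← map_Ψ₃]; rfl
  unfold ShapeIrrThree O5.numStableLinesAtThree
  rw [Finset.card_eq_zero, Multiset.toFinset_eq_empty, hbc]
  constructor
  · intro h
    refine Multiset.eq_zero_of_forall_notMem fun r hr ↦ h r ?_
    exact (mem_roots hne).1 hr
  · intro h r hr
    have : r ∈ ((W.Ψ₃).map (algebraMap ℚ ℚ_[3])).roots := (mem_roots hne).2 hr
    rw [h] at this
    exact Multiset.notMem_zero _ this

/-- **Dictionary with `O5.StableLineNonCyclotomicThree`'s square form**: `F(x₀) = 3·s²`, `s ≠ 0`, is an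
ORDM sign datum (odd valuation, unit part `≡ 1`) — the unit part of `3·s²` is the SQUARE of the unit
part of `s`, and squares of `3`-adic units are `≡ 1 (mod 3)`. [folklore] -/
theorem unitPartCongThree_one_of_eq_three_mul_sq {t s : ℚ_[3]} (hs : s ≠ 0) (h : t = 3 * s ^ 2) :
    Odd t.valuation ∧ UnitPartCongThree t 1 := by
  refine ⟨odd_valuation_of_eq_three_mul_sq hs h, ?_⟩
  have h3 : (3 : ℚ_[3]) ≠ 0 := by norm_num
  have hs2 : s ^ 2 ≠ 0 := pow_ne_zero 2 hs
  have ht : t ≠ 0 := by rw [h]; exact mul_ne_zero h3 hs2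
  have hv3 : (3 : ℚ_[3]).valuation = 1 := by simp
  -- the unit part of `t` is the square of the unit part of `s`
  have hval : t.valuation = 1 + 2 * s.valuation := by
    rw [h, Padic.valuation_mul h3 hs2, Padic.valuation_pow, hv3]; ring
  have hunit : unitPartThree t = unitPartThree s ^ 2 := by
    unfold unitPartThree
    rw [hval, h]
    have h3' : ((3 : ℕ) : ℚ_[3]) ≠ 0 := by exact_mod_cast h3
    have e2 : (((3 : ℕ) : ℚ_[3]) ^ (-s.valuation)) ^ 2 = ((3 : ℕ) : ℚ_[3]) ^ (-(2 * s.valuation)) := by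
      rw [← zpow_natCast, ← zpow_mul]
      congr 1
      push_cast
      ring
    have e3 : (3 : ℚ_[3]) * ((3 : ℕ) : ℚ_[3]) ^ (-(1 + 2 * s.valuation)) =
        ((3 : ℕ) : ℚ_[3]) ^ (-(2 * s.valuation)) := by
      rw [show (3 : ℚ_[3]) = ((3 : ℕ) : ℚ_[3]) ^ (1 : ℤ) by simp, ← zpow_add₀ h3']
      congr 1
      ring
    rw [mul_pow, e2, mul_comm (3 : ℚ_[3]) (s ^ 2), mul_assoc, e3]
  -- a unit `w` with `‖w − 1‖ < 1` or `‖w + 1‖ < 1` has `‖w² − 1‖ < 1`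
  unfold UnitPartCongThree
  rw [hunit]
  set w := unitPartThree s with hw
  have hw1 : ‖w‖ = 1 := norm_unitPartThree hs
  have key : ∀ ε : ℚ_[3], (ε = 1 ∨ ε = -1) → ‖w - ε‖ < 1 → ‖w ^ 2 - 1‖ < 1 := by
    rintro ε hε hlt
    have hfac : w ^ 2 - 1 = (w - ε) * (w + ε) := by
      rcases hε with rfl | rfl <;> ring
    rw [hfac, norm_mul]
    have hle : ‖w + ε‖ ≤ 1 := by
      refine (Padic.nonarchimedean _ _).trans (max_le hw1.le ?_)
      rcases hε with rfl | rfl <;> simp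
    calc ‖w - ε‖ * ‖w + ε‖ ≤ ‖w - ε‖ * 1 :=
          mul_le_mul_of_nonneg_left hle (norm_nonneg _)
      _ < 1 := by rw [mul_one]; exact hlt
  rcases unitPartCongThree_one_or_neg_one hs with h1 | h2
  · exact key 1 (Or.inl rfl) h1
  · exact key (-1) (Or.inr rfl) h2

end Partition

end Summit.BirchSwinnertonDyer.Rank1Residual.Additive

end
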